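import Summits.QuantumFields.YangMills.Theorems.BalabanUVNodesN15KingModelFullPropagatorOperatorEntries
import Literature.MathematicalPhysics.QuantumFieldTheory.King1986.CovarianceRateTorus

/-!
# BalabanUVNodes ∕ N15 — THE KING-MODEL RUNG, CURVED EDITION (PART X): [B9] (3.46)–(3.47) AT `U ≡ 1` — THE `L²` OPERATOR BOUNDS
# `‖A₀⁻¹‖ ≤ γ₀⁻¹`, `‖∇^η A₀⁻¹‖, ‖A₀⁻¹∇^{η*}‖ ≤ γ₀^{−1∕2}`, `‖∇^η_μ A₀⁻¹ ∇^{η*}_ν‖ ≤ 1` FOR KING'S FULL `A = 0` PROPAGATOR, UNIFORMLY in `K`, the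
# volume and the mass (`γ₀` = the tree's Dimock–Lemma-29 coercivity constant `gamA`)
# (Track A, DAG node N15 = NE2; FAN-OUT v1.1 §N15 s3 «KING-MODEL RUNG … + the one-line statement of what the curved case adds»)

HONEST FRAMING.  Count-neutral operator bookkeeping (cell `pub-ymgap`, seat `pub-ymgap-dag-n15-e` g9; `--supports stmt-QuantumFields-20544
--as helper` = K3⁷ `SpineGivenEndpointR13SepCoPH`, WORDS-143).  TEMPLATE LITERATURE, `A = 0`: C. King's scalar U(1)-Higgs MODEL on finite tori ([King1986]
(2.13) p. 653, (4.1)–(4.5) p. 670: `A₀ = η^d(−Δ^η + m²) + aQᵀQ`), NOT Bałaban's covariant objects.  [Balaban1985BackgroundPropagators] Thm 3.1 p. 398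
prints, after the sup∕Hölder entries (3.43)–(3.45), the GLOBAL `L²` entries (3.46) «`‖G(U)‖, ‖(∇G)(U)‖, ‖(G∇*)(U)‖ ≤ B₂`» and (3.47) «`‖(∇G∇*)(U)‖ ≤ B₂`»
(tree `B9.KernelFamily.l2G`, `l2DGD`; `B9.Ineq346_347`).  At `U ≡ 1` these are quadratic-form facts: the tree's LEMMA 29 ON THE TORUS
(`King1986.Torus.fineOp_coercive_unif`: `⟨ψ, A₀ψ⟩ ≥ γ_A‖ψ‖²`, `γ_A = gamA a (d+1)` independent of `N`, the volume and the mass, [Dimock2013] Lemma 29)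
and the summation-by-parts identity `⟨ψ, (N²(−Δ) + m²)ψ⟩ = m²‖ψ‖² + N²Σ_μ‖∇_μψ‖²` (§1).  Decided in the MODEL at `U ≡ 1`; NOT the printed
proposition (covariant `G(U)` over `Reg335`); NOT a node discharge; nothing continuum ∕ ℝ⁴ ∕ OS ∕ mass-gap ∕ Clay.  0 `sorry`, 0 `def`, standard axioms.

THE PROOF (three lines).  `ψ = A₀⁻¹f`: `γ‖ψ‖² ≤ ⟨ψ, A₀ψ⟩ = ⟨ψ, f⟩ ≤ ‖ψ‖‖f‖` gives `‖ψ‖ ≤ γ⁻¹‖f‖` and `N²‖∇_μψ‖² ≤ ⟨ψ, A₀ψ⟩ ≤ γ⁻¹‖f‖²`;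
`ψ = A₀⁻¹∇*_νg`: `Q := ⟨ψ, A₀ψ⟩ = ⟨ψ, ∇*_νg⟩ = ⟨∇_νψ, g⟩ ≤ (N²‖∇_νψ‖²)^{1∕2}‖g‖∕… ≤ Q^{1∕2}‖g‖`, so `Q ≤ ‖g‖²`, whence `‖ψ‖² ≤ γ⁻¹‖g‖²` and
`N²‖∇_μψ‖² ≤ Q ≤ ‖g‖²` — the last is (3.47) with constant ONE.
* §1 `lapF_form_eq` (`⟨x, (c(−Δ)+m²)x⟩ = m²‖x‖² + cΣ_μΣ_z(x(z+e_μ) − x(z))²`), `fineOp_form_ge_grad`;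
* §2 `fineOp_inv_l2_le`, `fineOp_grad_inv_l2_le`, `fineOp_inv_adj_form_le`, `fineOp_inv_adj_l2_le`, ★ `fineOp_grad_inv_adj_l2_le` — for `A₀ = fineOp N M a N² m²`
  with ANY coercivity constant `γ > 0`;
* §3 ★★ **`fullPropOps_l2_unif`** (the tree's `aK_ge`, `gamA_mono`) — King's tower `a_K`, `N = L^K`, cubes `2L^e`, `0 < m² `: ONE `γ₀ = gamA (a(1 − L⁻²)) (d+1) > 0` for all
  `K ≥ 1`, all volumes and masses: the four bounds at once.
WHAT THE CURVED CASE ADDS (one line): (3.46)–(3.47) for `G(U)` uniformly over `Reg335` ([B9] Prop. 1.1-type positivity of `Δ(U) + Q*Q`, printed).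
HONEST SCOPE.  (i) `A = 0`, periodic b.c.; (ii) King's spelling of `A₀` in lattice units of level `K` (`c = N²`), forward η-differences `N(ψ(z+e_μ) − ψ(z))`,
adjoint `(∇*_νg)(y) = N(g(y − e_ν) − g(y))`; plain `ℓ²` sums over the fine torus (any common weight cancels in operator norms); (iii) `a > 0`, odd `L ≥ 3`
for §3; (iv) not Bałaban's `G(U)`; not a discharge.
Locators: [Balaban1985BackgroundPropagators] Thm 3.1 (3.46)–(3.47) p. 398; [King1986] (2.13) p. 653, (4.1)–(4.5) p. 670; [Dimock2013] App. D Lemma 29.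
-/

noncomputable section

namespace Summit.QuantumFields.YangMills.BalabanUVNodes.N15KingModelRung.Curved

open Real Finset Matrix
open Literature.MathematicalPhysics.QuantumFieldTheory.Balaban1983to89 (Params)
open Literature.MathematicalPhysics.QuantumFieldTheory.Balaban1983to89.B5Prop11Plancherel (Tor fine unitVec)
open Literature.MathematicalPhysics.QuantumFieldTheory.Balaban1983to89.QGQInverse (Coercive)
open Literature.MathematicalPhysics.QuantumFieldTheory.King1986 (aK aK_pos aK_le aK_ge)
open Literature.MathematicalPhysics.QuantumFieldTheory.King1986.Torus (fineOp lapF blockProj gamA gamA_pos gamA_mono lapF_mulVec_apply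
  blockProj_form_nonneg fineOp_isUnit fineOp_coercive_unif)

variable {d : ℕ} (L : ℕ) [NeZero L]

/-! ## §1 The quadratic form of `c(−Δ) + m²` by summation by parts -/

omit [NeZero L] in
/-- **SUMMATION BY PARTS ON THE TORUS**: `⟨x, (c(−Δ) + m²)x⟩ = m²·Σ_z x(z)² + c·Σ_μ Σ_z (x(z + e_μ) − x(z))²`. [cite: King1986, (4.4) p.670] -/
theorem lapF_form_eq {dd : ℕ} (Kt : Fin dd → ℕ) [∀ μ, NeZero (Kt μ)] (c m2 : ℝ) (x : Tor Kt → ℝ) :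
    x ⬝ᵥ (lapF Kt c m2 *ᵥ x) = m2 * ∑ z, x z ^ 2 + c * ∑ μ, ∑ z, (x (z + unitVec Kt μ) - x z) ^ 2 := by
  have hshift : ∀ μ, ∑ z, x z * x (z - unitVec Kt μ) = ∑ z, x (z + unitVec Kt μ) * x z := by
    intro μ
    rw [← Equiv.sum_comp (Equiv.addRight (unitVec Kt μ)) (fun z => x z * x (z - unitVec Kt μ))]
    simp [add_sub_cancel_right]
  have hsq : ∀ μ, ∑ z, x (z + unitVec Kt μ) ^ 2 = ∑ z, x z ^ 2 := fun μ =>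
    Equiv.sum_comp (Equiv.addRight (unitVec Kt μ)) (fun z => x z ^ 2)
  have hlhs : x ⬝ᵥ (lapF Kt c m2 *ᵥ x)
      = (m2 + 2 * dd * c) * ∑ z, x z ^ 2 - c * ∑ μ, (2 * ∑ z, x (z + unitVec Kt μ) * x z) := by
    simp only [dotProduct, lapF_mulVec_apply]
    have e1 : ∀ z, x z * ((m2 + 2 * dd * c) * x z - c * ∑ μ, (x (z + unitVec Kt μ) + x (z - unitVec Kt μ)))
        = (m2 + 2 * dd * c) * x z ^ 2 - c * ∑ μ, (x z * x (z + unitVec Kt μ) + x z * x (z - unitVec Kt μ)) := by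
      intro z
      rw [Finset.mul_sum]
      ring_nf
      simp only [Finset.mul_sum]
      ring_nf
    rw [Finset.sum_congr rfl fun z _ => e1 z, Finset.sum_sub_distrib, ← Finset.mul_sum, ← Finset.mul_sum, Finset.sum_comm]
    congr 2
    refine Finset.sum_congr rfl fun μ _ => ?_
    rw [Finset.sum_add_distrib, hshift μ, two_mul]
    congr 1
    exact Finset.sum_congr rfl fun z _ => by ring
  have hrhs : ∑ μ, ∑ z, (x (z + unitVec Kt μ) - x z) ^ 2 = ∑ μ : Fin dd, (2 * ∑ z, x z ^ 2 - 2 * ∑ z, x (z + unitVec Kt μ) * x z) := by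
    refine Finset.sum_congr rfl fun μ _ => ?_
    have e2 : ∀ z, (x (z + unitVec Kt μ) - x z) ^ 2 = x (z + unitVec Kt μ) ^ 2 + x z ^ 2 - 2 * (x (z + unitVec Kt μ) * x z) :=
      fun z => by ring
    rw [Finset.sum_congr rfl fun z _ => e2 z, Finset.sum_sub_distrib, Finset.sum_add_distrib, hsq μ, ← Finset.mul_sum]
    ring
  rw [hlhs, hrhs, Finset.sum_sub_distrib, Finset.sum_const, Finset.card_univ, Fintype.card_fin]
  simp only [nsmul_eq_mul]
  ring

/-- **THE GRADIENT IS DOMINATED BY THE FORM OF `A₀`**: `c·Σ_z (x(z + e_ν) − x(z))² ≤ ⟨x, A₀x⟩` for `A₀ = c(−Δ) + m² + a·Q*Q` with `a, c, m² ≥ 0`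
(§1 + the tree's `blockProj_form_nonneg`). [cite: King1986, (4.1)–(4.5) p.670] -/
theorem fineOp_form_ge_grad (N : ℕ) [NeZero N] (M : Fin (d + 1) → ℕ) [∀ μ, NeZero (M μ)] {a c m2 : ℝ} (ha : 0 ≤ a) (hc : 0 ≤ c)
    (hm : 0 ≤ m2) (x : Tor (fine N M) → ℝ) (ν : Fin (d + 1)) :
    c * ∑ z, (x (z + unitVec (fine N M) ν) - x z) ^ 2 ≤ x ⬝ᵥ (fineOp N M a c m2 *ᵥ x) := by
  rw [fineOp, Matrix.add_mulVec, dotProduct_add, Matrix.smul_mulVec, dotProduct_smul, smul_eq_mul, lapF_form_eq]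
  have h1 : 0 ≤ m2 * ∑ z, x z ^ 2 := mul_nonneg hm (Finset.sum_nonneg fun z _ => sq_nonneg _)
  have h2 : 0 ≤ a * (x ⬝ᵥ (blockProj N M *ᵥ x)) := mul_nonneg ha (blockProj_form_nonneg N M x)
  have h3 : ∑ z, (x (z + unitVec (fine N M) ν) - x z) ^ 2 ≤ ∑ μ, ∑ z, (x (z + unitVec (fine N M) μ) - x z) ^ 2 :=
    Finset.single_le_sum (f := fun μ => ∑ z, (x (z + unitVec (fine N M) μ) - x z) ^ 2)
      (fun μ _ => Finset.sum_nonneg fun z _ => sq_nonneg _) (Finset.mem_univ ν)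
  nlinarith [mul_le_mul_of_nonneg_left h3 hc]

/-! ## §2 The four `L²` bounds for `A₀ = fineOp N M a N² m²` with a coercivity constant `γ` -/

section L2
variable (N : ℕ) [NeZero N] (M : Fin (d + 1) → ℕ) [∀ μ, NeZero (M μ)]

omit [NeZero L] in
/-- `A₀A₀⁻¹f = f` (`m² > 0`). [folklore] -/
theorem fineOp_mulVec_inv_mulVec {a m2 : ℝ} (ha : 0 ≤ a) (hm : 0 < m2) (f : Tor (fine N M) → ℝ) :
    fineOp N M a ((N : ℝ) ^ 2) m2 *ᵥ ((fineOp N M a ((N : ℝ) ^ 2) m2)⁻¹ *ᵥ f) = f := by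
  have hA := fineOp_isUnit N M (c := (N : ℝ) ^ 2) ha (by positivity) hm
  rw [Matrix.mulVec_mulVec, Matrix.mul_nonsing_inv _ ((Matrix.isUnit_iff_isUnit_det _).mp hA), Matrix.one_mulVec]

omit [NeZero L] in
/-- Cauchy–Schwarz for `⬝ᵥ`: `(u ⬝ᵥ v)² ≤ (u ⬝ᵥ u)(v ⬝ᵥ v)`. [folklore] -/
theorem dotProduct_sq_le (u v : Tor (fine N M) → ℝ) : (u ⬝ᵥ v) ^ 2 ≤ (u ⬝ᵥ u) * (v ⬝ᵥ v) := by
  have h := Finset.sum_mul_sq_le_sq_mul_sq Finset.univ u v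
  simp only [dotProduct, pow_two] at h ⊢
  simpa [pow_two] using h

omit [NeZero L] in
/-- **(3.46), FIRST ENTRY, AT `U ≡ 1`**: `‖A₀⁻¹f‖² ≤ γ⁻²‖f‖²` from `γ‖ψ‖² ≤ ⟨ψ, A₀ψ⟩ = ⟨ψ, f⟩ ≤ ‖ψ‖‖f‖`.
[cite: Balaban1985BackgroundPropagators, Thm 3.1 (3.46) p.398; King1986, (4.5) p.670] -/
theorem fineOp_inv_l2_le {a m2 γ : ℝ} (ha : 0 ≤ a) (hm : 0 < m2) (hγ : 0 < γ) (hco : Coercive (fineOp N M a ((N : ℝ) ^ 2) m2) γ)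
    (f : Tor (fine N M) → ℝ) :
    ((fineOp N M a ((N : ℝ) ^ 2) m2)⁻¹ *ᵥ f) ⬝ᵥ ((fineOp N M a ((N : ℝ) ^ 2) m2)⁻¹ *ᵥ f) ≤ (γ⁻¹) ^ 2 * (f ⬝ᵥ f) := by
  set ψ := (fineOp N M a ((N : ℝ) ^ 2) m2)⁻¹ *ᵥ f with hψ
  have h1 : γ * (ψ ⬝ᵥ ψ) ≤ ψ ⬝ᵥ f := by
    have h := hco ψ
    rwa [hψ, fineOp_mulVec_inv_mulVec N M ha hm f, ← hψ] at h
  have h0 : 0 ≤ ψ ⬝ᵥ ψ := by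
    simp only [dotProduct]; exact Finset.sum_nonneg fun i _ => mul_self_nonneg _
  have hf0 : 0 ≤ f ⬝ᵥ f := by
    simp only [dotProduct]; exact Finset.sum_nonneg fun i _ => mul_self_nonneg _
  have hcs := dotProduct_sq_le N M ψ f
  -- `γ²(ψ⬝ψ)² ≤ (ψ⬝f)² ≤ (ψ⬝ψ)(f⬝f)`
  have h2 : (γ * (ψ ⬝ᵥ ψ)) ^ 2 ≤ (ψ ⬝ᵥ ψ) * (f ⬝ᵥ f) :=
    (pow_le_pow_left₀ (by positivity) h1 2).trans hcs
  by_cases hz : ψ ⬝ᵥ ψ = 0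
  · rw [hz]; positivity
  have hpos : 0 < ψ ⬝ᵥ ψ := lt_of_le_of_ne h0 (Ne.symm hz)
  have h3 : γ ^ 2 * (ψ ⬝ᵥ ψ) ≤ f ⬝ᵥ f := by
    have : γ ^ 2 * (ψ ⬝ᵥ ψ) * (ψ ⬝ᵥ ψ) ≤ (f ⬝ᵥ f) * (ψ ⬝ᵥ ψ) := by nlinarith
    exact le_of_mul_le_mul_right this hpos
  rw [inv_pow, le_inv_mul_iff₀ (by positivity : (0 : ℝ) < γ ^ 2)]
  exact h3

omit [NeZero L] in
/-- **(3.46), SECOND ENTRY, AT `U ≡ 1`**: `N²·Σ_z((A₀⁻¹f)(z + e_μ) − (A₀⁻¹f)(z))² ≤ γ⁻¹‖f‖²` (`N²‖∇_μψ‖² ≤ ⟨ψ, A₀ψ⟩ = ⟨ψ, f⟩ ≤ ‖ψ‖‖f‖ ≤ γ⁻¹‖f‖²`).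
[cite: Balaban1985BackgroundPropagators, Thm 3.1 (3.46) p.398; King1986, (4.5) p.670] -/
theorem fineOp_grad_inv_l2_le {a m2 γ : ℝ} (ha : 0 ≤ a) (hm : 0 < m2) (hγ : 0 < γ) (hco : Coercive (fineOp N M a ((N : ℝ) ^ 2) m2) γ)
    (f : Tor (fine N M) → ℝ) (μ : Fin (d + 1)) :
    (N : ℝ) ^ 2 * ∑ z, (((fineOp N M a ((N : ℝ) ^ 2) m2)⁻¹ *ᵥ f) (z + unitVec (fine N M) μ) - ((fineOp N M a ((N : ℝ) ^ 2) m2)⁻¹ *ᵥ f) z) ^ 2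
      ≤ γ⁻¹ * (f ⬝ᵥ f) := by
  set ψ := (fineOp N M a ((N : ℝ) ^ 2) m2)⁻¹ *ᵥ f with hψ
  have hAψ : fineOp N M a ((N : ℝ) ^ 2) m2 *ᵥ ψ = f := by rw [hψ]; exact fineOp_mulVec_inv_mulVec N M ha hm f
  have hgrad := fineOp_form_ge_grad N M ha (by positivity : (0 : ℝ) ≤ (N : ℝ) ^ 2) hm.le ψ μ
  rw [hAψ] at hgrad
  have h1 : γ * (ψ ⬝ᵥ ψ) ≤ ψ ⬝ᵥ f := by have h := hco ψ; rwa [hAψ] at h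
  have h0 : 0 ≤ ψ ⬝ᵥ ψ := by
    simp only [dotProduct]; exact Finset.sum_nonneg fun i _ => mul_self_nonneg _
  have hf0 : 0 ≤ f ⬝ᵥ f := by
    simp only [dotProduct]; exact Finset.sum_nonneg fun i _ => mul_self_nonneg _
  have hψf0 : 0 ≤ ψ ⬝ᵥ f := le_trans (by positivity) h1
  have hl2 := fineOp_inv_l2_le N M ha hm hγ hco f
  rw [← hψ] at hl2
  -- `(ψ⬝f)² ≤ (ψ⬝ψ)(f⬝f) ≤ γ⁻²(f⬝f)²`
  have h2 : (ψ ⬝ᵥ f) ^ 2 ≤ (γ⁻¹ * (f ⬝ᵥ f)) ^ 2 := by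
    calc (ψ ⬝ᵥ f) ^ 2 ≤ (ψ ⬝ᵥ ψ) * (f ⬝ᵥ f) := dotProduct_sq_le N M ψ f
      _ ≤ (γ⁻¹) ^ 2 * (f ⬝ᵥ f) * (f ⬝ᵥ f) := mul_le_mul_of_nonneg_right hl2 hf0
      _ = (γ⁻¹ * (f ⬝ᵥ f)) ^ 2 := by ring
  have h3 : ψ ⬝ᵥ f ≤ γ⁻¹ * (f ⬝ᵥ f) := (pow_le_pow_iff_left₀ hψf0 (by positivity) two_ne_zero).mp h2
  exact hgrad.trans h3

omit [NeZero L] in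
/-- **THE ADJOINT SOURCE: `⟨A₀⁻¹∇*_νg, ∇*_νg⟩ ≤ ‖g‖²`** (`(∇*_νg)(y) = N(g(y − e_ν) − g(y))`): with `ψ = A₀⁻¹∇*_νg`, `Q = ⟨ψ, A₀ψ⟩ = ⟨ψ, ∇*_νg⟩ = N·Σ_z(ψ(z+e_ν) − ψ(z))g(z)`
(summation by parts) `≤ (N²‖∇_νψ‖²)^{1∕2}‖g‖ ≤ Q^{1∕2}‖g‖`. [cite: Balaban1985BackgroundPropagators, Thm 3.1 (3.46)–(3.47) p.398; King1986, (4.5) p.670] -/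
theorem fineOp_inv_adj_form_le {a m2 : ℝ} (ha : 0 ≤ a) (hm : 0 < m2) (g : Tor (fine N M) → ℝ) (ν : Fin (d + 1)) :
    ((fineOp N M a ((N : ℝ) ^ 2) m2)⁻¹ *ᵥ (fun y => (N : ℝ) * (g (y - unitVec (fine N M) ν) - g y)))
        ⬝ᵥ (fun y => (N : ℝ) * (g (y - unitVec (fine N M) ν) - g y)) ≤ g ⬝ᵥ g := by
  set h : Tor (fine N M) → ℝ := fun y => (N : ℝ) * (g (y - unitVec (fine N M) ν) - g y) with hh
  set ψ := (fineOp N M a ((N : ℝ) ^ 2) m2)⁻¹ *ᵥ h with hψ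
  have hAψ : fineOp N M a ((N : ℝ) ^ 2) m2 *ᵥ ψ = h := by rw [hψ]; exact fineOp_mulVec_inv_mulVec N M ha hm h
  -- summation by parts
  have hsbp : ψ ⬝ᵥ h = (N : ℝ) * ∑ z, (ψ (z + unitVec (fine N M) ν) - ψ z) * g z := by
    have hshift : ∑ z, ψ z * g (z - unitVec (fine N M) ν) = ∑ z, ψ (z + unitVec (fine N M) ν) * g z := by
      rw [← Equiv.sum_comp (Equiv.addRight (unitVec (fine N M) ν)) (fun z => ψ z * g (z - unitVec (fine N M) ν))]
      simp [add_sub_cancel_right]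
    simp only [dotProduct, hh]
    have e1 : ∀ z, ψ z * ((N : ℝ) * (g (z - unitVec (fine N M) ν) - g z))
        = (N : ℝ) * (ψ z * g (z - unitVec (fine N M) ν)) - (N : ℝ) * (ψ z * g z) := fun z => by ring
    rw [Finset.sum_congr rfl fun z _ => e1 z, Finset.sum_sub_distrib, ← Finset.mul_sum, ← Finset.mul_sum, hshift, ← mul_sub,
      ← Finset.sum_sub_distrib]
    congr 1
    exact Finset.sum_congr rfl fun z _ => by ring
  -- the gradient form bound and Cauchy–Schwarz
  have hgrad := fineOp_form_ge_grad N M ha (by positivity : (0 : ℝ) ≤ (N : ℝ) ^ 2) hm.le ψ ν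
  rw [hAψ] at hgrad
  have hg0 : 0 ≤ g ⬝ᵥ g := by
    simp only [dotProduct]; exact Finset.sum_nonneg fun i _ => mul_self_nonneg _
  have hQ0 : 0 ≤ ψ ⬝ᵥ h := le_trans (by positivity) hgrad
  have hcs := Finset.sum_mul_sq_le_sq_mul_sq Finset.univ (fun z => ψ (z + unitVec (fine N M) ν) - ψ z) g
  have hgg : ∑ z, g z ^ 2 = g ⬝ᵥ g := by simp only [dotProduct, pow_two]
  rw [hgg] at hcs
  -- `Q² ≤ N²‖∇ψ‖²·‖g‖² ≤ Q·‖g‖²`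
  have hQ2 : (ψ ⬝ᵥ h) ^ 2 ≤ (ψ ⬝ᵥ h) * (g ⬝ᵥ g) := by
    calc (ψ ⬝ᵥ h) ^ 2 = (N : ℝ) ^ 2 * (∑ z, (ψ (z + unitVec (fine N M) ν) - ψ z) * g z) ^ 2 := by rw [hsbp]; ring
      _ ≤ (N : ℝ) ^ 2 * ((∑ z, (ψ (z + unitVec (fine N M) ν) - ψ z) ^ 2) * (g ⬝ᵥ g)) :=
          mul_le_mul_of_nonneg_left hcs (by positivity)
      _ = ((N : ℝ) ^ 2 * ∑ z, (ψ (z + unitVec (fine N M) ν) - ψ z) ^ 2) * (g ⬝ᵥ g) := by ring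
      _ ≤ (ψ ⬝ᵥ h) * (g ⬝ᵥ g) := mul_le_mul_of_nonneg_right hgrad hg0
  by_cases hz : ψ ⬝ᵥ h = 0
  · rw [hz]; exact hg0
  have hpos : 0 < ψ ⬝ᵥ h := lt_of_le_of_ne hQ0 (Ne.symm hz)
  have : (ψ ⬝ᵥ h) * (ψ ⬝ᵥ h) ≤ (g ⬝ᵥ g) * (ψ ⬝ᵥ h) := by nlinarith
  exact le_of_mul_le_mul_right this hpos

omit [NeZero L] in
/-- **(3.46), THIRD ENTRY, AT `U ≡ 1`**: `‖A₀⁻¹∇*_νg‖² ≤ γ⁻¹‖g‖²` (`γ‖ψ‖² ≤ ⟨ψ, A₀ψ⟩ ≤ ‖g‖²`).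
[cite: Balaban1985BackgroundPropagators, Thm 3.1 (3.46) p.398; King1986, (4.5) p.670] -/
theorem fineOp_inv_adj_l2_le {a m2 γ : ℝ} (ha : 0 ≤ a) (hm : 0 < m2) (hγ : 0 < γ) (hco : Coercive (fineOp N M a ((N : ℝ) ^ 2) m2) γ)
    (g : Tor (fine N M) → ℝ) (ν : Fin (d + 1)) :
    ((fineOp N M a ((N : ℝ) ^ 2) m2)⁻¹ *ᵥ (fun y => (N : ℝ) * (g (y - unitVec (fine N M) ν) - g y)))
        ⬝ᵥ ((fineOp N M a ((N : ℝ) ^ 2) m2)⁻¹ *ᵥ (fun y => (N : ℝ) * (g (y - unitVec (fine N M) ν) - g y)))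
      ≤ γ⁻¹ * (g ⬝ᵥ g) := by
  set h : Tor (fine N M) → ℝ := fun y => (N : ℝ) * (g (y - unitVec (fine N M) ν) - g y) with hh
  set ψ := (fineOp N M a ((N : ℝ) ^ 2) m2)⁻¹ *ᵥ h with hψ
  have hAψ : fineOp N M a ((N : ℝ) ^ 2) m2 *ᵥ ψ = h := by rw [hψ]; exact fineOp_mulVec_inv_mulVec N M ha hm h
  have h1 : γ * (ψ ⬝ᵥ ψ) ≤ ψ ⬝ᵥ h := by have h := hco ψ; rwa [hAψ] at h
  have h2 : ψ ⬝ᵥ h ≤ g ⬝ᵥ g := fineOp_inv_adj_form_le N M ha hm g ν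
  rw [le_inv_mul_iff₀ hγ]
  exact h1.trans h2

omit [NeZero L] in
/-- **(3.47) AT `U ≡ 1`, CONSTANT ONE**: `N²·Σ_z((A₀⁻¹∇*_νg)(z + e_μ) − (A₀⁻¹∇*_νg)(z))² ≤ ‖g‖²` — `‖∇_μA₀⁻¹∇*_ν‖_{ℓ²→ℓ²} ≤ 1`
(`N²‖∇_μψ‖² ≤ ⟨ψ, A₀ψ⟩ ≤ ‖g‖²`); no coercivity constant enters. [cite: Balaban1985BackgroundPropagators, Thm 3.1 (3.47) p.398; King1986, (4.5) p.670] -/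
theorem fineOp_grad_inv_adj_l2_le {a m2 : ℝ} (ha : 0 ≤ a) (hm : 0 < m2) (g : Tor (fine N M) → ℝ) (μ ν : Fin (d + 1)) :
    (N : ℝ) ^ 2 * ∑ z,
        (((fineOp N M a ((N : ℝ) ^ 2) m2)⁻¹ *ᵥ (fun y => (N : ℝ) * (g (y - unitVec (fine N M) ν) - g y))) (z + unitVec (fine N M) μ)
          - ((fineOp N M a ((N : ℝ) ^ 2) m2)⁻¹ *ᵥ (fun y => (N : ℝ) * (g (y - unitVec (fine N M) ν) - g y))) z) ^ 2
      ≤ g ⬝ᵥ g := by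
  set h : Tor (fine N M) → ℝ := fun y => (N : ℝ) * (g (y - unitVec (fine N M) ν) - g y) with hh
  set ψ := (fineOp N M a ((N : ℝ) ^ 2) m2)⁻¹ *ᵥ h with hψ
  have hAψ : fineOp N M a ((N : ℝ) ^ 2) m2 *ᵥ ψ = h := by rw [hψ]; exact fineOp_mulVec_inv_mulVec N M ha hm h
  have hgrad := fineOp_form_ge_grad N M ha (by positivity : (0 : ℝ) ≤ (N : ℝ) ^ 2) hm.le ψ μ
  rw [hAψ] at hgrad
  exact hgrad.trans (fineOp_inv_adj_form_le N M ha hm g ν)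

end L2

/-! ## §3 King's tower: ONE coercivity constant for all `K ≥ 1`, all volumes and masses; the four bounds at once -/

omit [NeZero L] in
/-- **[B9] (3.46)–(3.47) AT `U ≡ 1` FOR KING'S FULL `A = 0` FLUCTUATION PROPAGATOR, UNIFORMLY IN `K`, THE VOLUME AND THE MASS.**  For odd `L ≥ 3` and
`a > 0` there is ONE `γ₀ > 0` (`= gamA (a(1 − L⁻²)) (d+1)`, a function of `d, L, a` only) such that for every `K ≥ 1` (spelling `N = L^K`), EVERY torus
`M`, every mass `m² > 0`, all directions `μ, ν` and all `f, g` on the fine torus, with `A₀ = fineOp N M a_K N² m²`, `(∇*_νg)(y) = N(g(y − e_ν) − g(y))`: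
`‖A₀⁻¹f‖² ≤ γ₀⁻²‖f‖²`, `N²‖∇_μA₀⁻¹f‖² ≤ γ₀⁻¹‖f‖²`, `‖A₀⁻¹∇*_νg‖² ≤ γ₀⁻¹‖g‖²`, `N²‖∇_μA₀⁻¹∇*_νg‖² ≤ ‖g‖²` — the printed «`‖G(U)‖, ‖(∇G)(U)‖, ‖(G∇*)(U)‖ ≤ B₂;
‖(∇G∇*)(U)‖ ≤ B₂`» at `U ≡ 1` with `B₂ = max(γ₀⁻¹, γ₀^{−1∕2}, 1)`.
[cite: Balaban1985BackgroundPropagators, Thm 3.1 (3.46)–(3.47) p.398; King1986, (2.13)–(2.15) p.653, (4.5) p.670; Dimock2013, App. D Lemma 29] -/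
theorem fullPropOps_l2_unif (hL : 2 ≤ L) {a : ℝ} (ha : 0 < a) :
    ∃ γ₀ : ℝ, 0 < γ₀ ∧ ∀ (K : ℕ), 1 ≤ K → ∀ (N : ℕ) [NeZero N], N = L ^ K →
      ∀ (M : Fin (d + 1) → ℕ) [∀ μ, NeZero (M μ)] (msq : ℝ), 0 < msq → ∀ (μ ν : Fin (d + 1)) (f g : Tor (fine N M) → ℝ),
        ((fineOp N M (aK a L K) (((N : ℕ) : ℝ) ^ 2) msq)⁻¹ *ᵥ f) ⬝ᵥ ((fineOp N M (aK a L K) (((N : ℕ) : ℝ) ^ 2) msq)⁻¹ *ᵥ f)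
            ≤ (γ₀⁻¹) ^ 2 * (f ⬝ᵥ f) ∧
        (N : ℝ) ^ 2 * ∑ z, (((fineOp N M (aK a L K) (((N : ℕ) : ℝ) ^ 2) msq)⁻¹ *ᵥ f) (z + unitVec (fine N M) μ)
            - ((fineOp N M (aK a L K) (((N : ℕ) : ℝ) ^ 2) msq)⁻¹ *ᵥ f) z) ^ 2 ≤ γ₀⁻¹ * (f ⬝ᵥ f) ∧
        ((fineOp N M (aK a L K) (((N : ℕ) : ℝ) ^ 2) msq)⁻¹ *ᵥ (fun y => (N : ℝ) * (g (y - unitVec (fine N M) ν) - g y)))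
            ⬝ᵥ ((fineOp N M (aK a L K) (((N : ℕ) : ℝ) ^ 2) msq)⁻¹ *ᵥ (fun y => (N : ℝ) * (g (y - unitVec (fine N M) ν) - g y)))
          ≤ γ₀⁻¹ * (g ⬝ᵥ g) ∧
        (N : ℝ) ^ 2 * ∑ z,
            (((fineOp N M (aK a L K) (((N : ℕ) : ℝ) ^ 2) msq)⁻¹ *ᵥ (fun y => (N : ℝ) * (g (y - unitVec (fine N M) ν) - g y)))
                (z + unitVec (fine N M) μ)
              - ((fineOp N M (aK a L K) (((N : ℕ) : ℝ) ^ 2) msq)⁻¹ *ᵥ (fun y => (N : ℝ) * (g (y - unitVec (fine N M) ν) - g y))) z) ^ 2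
          ≤ g ⬝ᵥ g := by
  have hL1 : 1 < L := by omega
  have hLr : (1 : ℝ) < L := by exact_mod_cast hL1
  have ha' : 0 < a * (1 - ((L : ℝ) ^ 2)⁻¹) := by
    have hL2 : 1 < (L : ℝ) ^ 2 := one_lt_pow₀ hLr two_ne_zero
    exact mul_pos ha (by rw [sub_pos]; exact inv_lt_one_of_one_lt₀ hL2)
  refine ⟨gamA (a * (1 - ((L : ℝ) ^ 2)⁻¹)) (d + 1), gamA_pos ha' (d + 1), ?_⟩
  intro K hK N _ hN M _ msq hmsq μ ν f g
  have hN1 : 1 ≤ N := by rw [hN]; exact Nat.one_le_pow K L (by omega)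
  have haK0 : 0 ≤ aK a (L : ℝ) K := (aK_pos ha hLr hK).le
  have hco' := fineOp_coercive_unif N M hN1 haK0 hmsq.le
  have hco : Coercive (fineOp N M (aK a L K) (((N : ℕ) : ℝ) ^ 2) msq) (gamA (a * (1 - ((L : ℝ) ^ 2)⁻¹)) (d + 1)) := by
    intro x
    have hx0 : 0 ≤ x ⬝ᵥ x := by
      simp only [dotProduct]; exact Finset.sum_nonneg fun i _ => mul_self_nonneg _
    exact (mul_le_mul_of_nonneg_right (gamA_mono (aK_ge ha hLr hK) (d + 1)) hx0).trans (hco' x)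
  have hγ := gamA_pos ha' (d + 1)
  exact ⟨fineOp_inv_l2_le N M haK0 hmsq hγ hco f, fineOp_grad_inv_l2_le N M haK0 hmsq hγ hco f μ,
    fineOp_inv_adj_l2_le N M haK0 hmsq hγ hco g ν, fineOp_grad_inv_adj_l2_le N M haK0 hmsq g μ ν⟩

end Summit.QuantumFields.YangMills.BalabanUVNodes.N15KingModelRung.Curved
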